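import Literature.AlgebraicTopology.SingularHomology.EquivariantSingularChains
import Literature.AlgebraicTopology.SingularHomology.DoubleCoverTransfer
import Mathlib.RepresentationTheory.Homological.GroupCohomology.Basic
import Mathlib.Topology.Covering.Quotient
import HarnessLib

/-!
# Equivariant cochains of a covering `G`-space are the cochains of the quotient:
# `Hom_G(C_•(E; k), M) ≅ C^•(E/G; M)` and `Hⁿ(G; M) ≅ Hⁿ(E/G; M)` for acyclic `E`

Topic `Literature/AlgebraicTopology/SingularHomology`; continuation of
`EquivariantSingularChains.lean`.  K. S. Brown, *Cohomology of Groups* (1982), Ch. I §4–§5 and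
Prop. II.4.1 ("if `Y` is a `K(G,1)` then `H^*(G; M) ≅ H^*(Y; M)`": the singular chains of the
universal cover form a free resolution and `Hom_G(C_*(Ỹ), M) = C^*(Y; M)`); A. Hatcher,
*Algebraic Topology* (2002), Props. 1.33–1.34 (singular simplices of the base lift, uniquely up to
the deck group) and §3.H.

Setting: `G` acts on `E`, `p : E → B` is a quotient covering map for the action (Mathlib
`IsQuotientCoveringMap p G`; e.g. the universal cover of
`Literature/Topology/CoveringSpaces/UniversalCover.lean` with its `π₁`-action), `k` a commutative
ring, `M` a `k`-module with the trivial `G`-action.  Everything below is PROVED: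

* `Equivariant.liftSimplex hp σ` — a chosen lift to `E` of a singular simplex `σ` of `B`
  (`SingularSimplex.lift` of `DoubleCoverTransfer.lean`); `Equivariant.exists_smul_eq_of_map_eq` —
  two simplices of `E` over the same simplex of `B` differ by a deck transformation;
* `Equivariant.hom_single_eq_of_map_eq` — a `G`-morphism `Cₙ(E; k) → M` takes one value on all
  lifts of a simplex;
* **`Equivariant.cochainEquiv`** — `Hom_{Rep k G}(Cₙ(E; k), M) ≃ₗ[k] (SingularSimplex B n → M)`,
  `f ↦ (σ ↦ f [σ̃])`, inverse `φ ↦ (r τ ↦ r φ (p ∘ τ))`; **`Equivariant.cochainIso`** — these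
  assemble to an isomorphism of cochain complexes `Hom_G(C_•(E; k), M) ≅ C^•(B; M)` with the
  tree's cochain complex `singularCochainComplex k M B` (`SingularCochains.lean`);
* **`Equivariant.groupCohomologyIsoSingularCohomology`** — for `E` moreover path connected and
  acyclic in positive degrees (the action is free automatically): `Hⁿ(G; M) ≅ Hⁿ(B; M)`,
  Mathlib's `groupCohomology (Rep.trivial k G M) n` on the left (via `groupCohomologyIso` and the
  free resolution `Equivariant.resolution`), the tree's `singularCohomology k M B n` on the right
  (Brown 1982, Prop. II.4.1 for `E` contractible).

## References

* K. S. Brown, *Cohomology of Groups*, GTM 87, Springer 1982, Ch. I §4–5, Prop. II.4.1.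
  [Brown1982CohomologyGroups]
* A. Hatcher, *Algebraic Topology*, CUP 2002, Props. 1.33–1.34, §3.H. [HatcherAT2002]
-/

noncomputable section

set_option backward.isDefEq.respectTransparency false

open CategoryTheory CategoryTheory.Limits Opposite Simplicial AlgebraicTopology

universe u

namespace Literature.AlgebraicTopology.SingularHomology

namespace Equivariant

variable (k : Type u) [CommRing k] (G : Type u) [Group G] {E : Type u} [TopologicalSpace E]
  [MulAction G E] {B : Type u} [TopologicalSpace B] {p : E → B} (hp : IsQuotientCoveringMap p G)

/-! ### Lifting simplices of the quotient -/

section Lift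

variable {k G}

/-- The covering projection as a continuous map (packaged with the continuity proof of the
covering map, so that `SingularSimplex.lift_map` applies verbatim). [folklore] -/
abbrev projCM : C(E, B) := ⟨p, hp.isCoveringMap.continuous⟩

/-- **A chosen lift** `σ̃` to `E` of a singular simplex `σ` of `B` (Hatcher 2002, Prop. 1.33: the
standard simplex is simply connected and locally path connected, and `p` is onto).
[cite: HatcherAT2002, §1.3 Prop. 1.33] -/
def liftSimplex {n : ℕ} (σ : SingularSimplex B n) : SingularSimplex E n :=
  SingularSimplex.lift hp.isCoveringMap σ (Classical.choose (hp.surjective (σ.vertex 0)))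
    (Classical.choose_spec (hp.surjective (σ.vertex 0)))

/-- The chosen lift lies over `σ`. [cite: HatcherAT2002, §1.3 Prop. 1.33] -/
@[simp] theorem liftSimplex_map {n : ℕ} (σ : SingularSimplex B n) :
    (liftSimplex hp σ).map (projCM hp) = σ :=
  SingularSimplex.lift_map _ _ _ _

variable [ContinuousConstSMul G E]

/-- `p ∘ (g • τ) = p ∘ τ` for singular simplices `τ` of `E`. [folklore] -/
theorem map_projCM_smul {n : ℕ} (g : G) (τ : SingularSimplex E n) :
    (g • τ).map (projCM hp) = τ.map (projCM hp) :=
  SingularSimplex.map_smul_of_forall_apply_smul _ (fun g _ => hp.map_smul g) g τ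

/-- **Two singular simplices of `E` over the same simplex of `B` differ by a deck transformation**
(Hatcher 2002, Prop. 1.34: a lift is determined by one of its points, and the fibres of `p` are
the `G`-orbits). [cite: HatcherAT2002, §1.3 Prop. 1.34] -/
theorem exists_smul_eq_of_map_eq {n : ℕ} {τ₁ τ₂ : SingularSimplex E n}
    (h : τ₁.map (projCM hp) = τ₂.map (projCM hp)) : ∃ g : G, g • τ₂ = τ₁ := by
  have hv : p (τ₁.vertex 0) = p (τ₂.vertex 0) := by
    have h' := congrArg (fun σ : SingularSimplex B n => σ.vertex 0) h
    simpa only [SingularSimplex.vertex_map, ContinuousMap.coe_mk] using h'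
  obtain ⟨g, hg⟩ := MulAction.mem_orbit_iff.1 (hp.apply_eq_iff_mem_orbit.1 hv)
  refine ⟨g, SingularSimplex.eq_of_map_eq_of_vertex_eq hp.isCoveringMap ?_ ?_⟩
  · rw [map_projCM_smul, h]
  · rw [SingularSimplex.smul_def, SingularSimplex.vertex_map]
    exact hg

end Lift

/-! ### Equivariant cochains of `E` = cochains of `B` -/

variable [ContinuousConstSMul G E] (M : Type u) [AddCommGroup M] [Module k M]

/-- **A `G`-morphism `Cₙ(E; k) → M` (`M` with the trivial action) takes the same value on
simplices in one orbit**, in particular on all lifts of a simplex of `B`.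
[cite: Brown1982CohomologyGroups, Ch. I §5] -/
theorem hom_single_eq_of_map_eq {n : ℕ} (f : (chains k G E).X n ⟶ Rep.trivial k G M)
    {τ₁ τ₂ : SingularSimplex E n} (h : τ₁.map (projCM hp) = τ₂.map (projCM hp)) (r : k) :
    f.hom (Finsupp.single τ₁ r) = f.hom (Finsupp.single τ₂ r) := by
  obtain ⟨g, rfl⟩ := exists_smul_eq_of_map_eq hp h
  rw [← chainRep_single]
  exact Rep.hom_comm_apply f g (Finsupp.single τ₂ r)

/-- The cochain of `B` defined by an equivariant cochain `f` of `E`: `σ ↦ f [σ̃]`.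
[cite: Brown1982CohomologyGroups, Ch. I §5] -/
def toCochain {n : ℕ} (f : (chains k G E).X n ⟶ Rep.trivial k G M) : SingularSimplex B n → M :=
  fun σ => f.hom (Finsupp.single (liftSimplex hp σ) 1)

/-- `toCochain f σ = f [τ]` for ANY lift `τ` of `σ`. [cite: Brown1982CohomologyGroups, Ch. I §5] -/
theorem toCochain_eq {n : ℕ} (f : (chains k G E).X n ⟶ Rep.trivial k G M)
    {τ : SingularSimplex E n} {σ : SingularSimplex B n} (h : τ.map (projCM hp) = σ) :
    toCochain k G hp M f σ = f.hom (Finsupp.single τ 1) :=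
  hom_single_eq_of_map_eq k G hp M f (by rw [liftSimplex_map, h]) 1

/-- The equivariant cochain of `E` defined by a cochain `φ` of `B`: `r τ ↦ r φ (p ∘ τ)`, a
morphism of representations to the trivial representation on `M`.
[cite: Brown1982CohomologyGroups, Ch. I §5] -/
def ofCochain {n : ℕ} (φ : SingularSimplex B n → M) : (chains k G E).X n ⟶ Rep.trivial k G M :=
  Rep.ofHom
    { toLinearMap :=
        Finsupp.linearCombination k fun τ : SingularSimplex E n => φ (τ.map (projCM hp))
      isIntertwining' := fun g => by
        refine Finsupp.lhom_ext fun τ r => ?_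
        rw [LinearMap.comp_apply, LinearMap.comp_apply]
        change Finsupp.linearCombination k (fun τ : SingularSimplex E n => φ (τ.map (projCM hp)))
            (chainRep k G E (op ⦋n⦌) g (Finsupp.single τ r)) =
          Representation.trivial k G M g (Finsupp.linearCombination k
            (fun τ : SingularSimplex E n => φ (τ.map (projCM hp))) (Finsupp.single τ r))
        rw [chainRep_single, Finsupp.linearCombination_single, Finsupp.linearCombination_single,
          Representation.trivial_apply, map_projCM_smul] }

/-- `ofCochain φ` on an elementary chain: `r τ ↦ r • φ (p ∘ τ)`. [folklore] -/
@[simp] theorem ofCochain_hom_single {n : ℕ} (φ : SingularSimplex B n → M)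
    (τ : SingularSimplex E n) (r : k) :
    (ofCochain k G hp M φ).hom (Finsupp.single τ r) = r • φ (τ.map (projCM hp)) := by
  change Finsupp.linearCombination k (fun τ : SingularSimplex E n => φ (τ.map (projCM hp)))
    (Finsupp.single τ r) = _
  rw [Finsupp.linearCombination_single]

/-- **`Hom_{Rep k G}(Cₙ(E; k), M) ≃ Cⁿ(B; M)`** (Brown 1982, I §5; Hatcher §3.H: "`Hom_G(Cₙ(X̃), M)`
can be identified with the functions from singular `n`-simplices of `X` to `M`"), as a `k`-linear
equivalence. [cite: Brown1982CohomologyGroups, Ch. I §5] -/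
def cochainEquiv (n : ℕ) :
    ((chains k G E).X n ⟶ Rep.trivial k G M) ≃ₗ[k] (SingularSimplex B n → M) where
  toFun := toCochain k G hp M
  invFun := ofCochain k G hp M
  map_add' _ _ := rfl
  map_smul' _ _ := rfl
  left_inv f := by
    refine Rep.hom_ext (Representation.IntertwiningMap.ext
      (Finsupp.lhom_ext fun (τ : SingularSimplex E n) r => ?_))
    change (ofCochain k G hp M (toCochain k G hp M f)).hom (Finsupp.single τ r) =
      f.hom (Finsupp.single τ r)
    rw [ofCochain_hom_single, toCochain_eq k G hp M f (rfl : τ.map (projCM hp) = _),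
      ← map_smul f.hom r, Finsupp.smul_single_one]
  right_inv φ := by
    funext σ
    change (ofCochain k G hp M φ).hom (Finsupp.single (liftSimplex hp σ) 1) = φ σ
    rw [ofCochain_hom_single, one_smul, liftSimplex_map]

/-- `cochainEquiv` is `toCochain`. [folklore] -/
theorem cochainEquiv_apply {n : ℕ} (f : (chains k G E).X n ⟶ Rep.trivial k G M) :
    cochainEquiv k G hp M n f = toCochain k G hp M f := rfl

/-- `toCochain` is a cochain map: `δ (toCochain f) = toCochain (∂ ≫ f)`, because the faces of a
lift are lifts of the faces. [cite: Brown1982CohomologyGroups, Ch. I §5] -/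
theorem d_toCochain (i : ℕ) (f : (chains k G E).X i ⟶ Rep.trivial k G M) :
    (singularCochainComplex k M B).d i (i + 1) (toCochain k G hp M f) =
      toCochain k G hp M ((chains k G E).d (i + 1) i ≫ f) := by
  funext σ
  rw [singularCochainComplex.d_apply]
  change _ = f.hom (((chains k G E).d (i + 1) i).hom (Finsupp.single (liftSimplex hp σ) 1))
  rw [d_hom_single, map_sum]
  refine Finset.sum_congr rfl fun l _ => ?_
  rw [map_smul, toCochain_eq k G hp M f (τ := (liftSimplex hp σ).face l)
    (by rw [← SingularSimplex.face_map, liftSimplex_map])]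

/-- **`Hom_G(C_•(E; k), M) ≅ C^•(B; M)` as cochain complexes of `k`-modules** (Brown 1982, I §5):
the degreewise equivalences `cochainEquiv` commute with the coboundaries (`d_toCochain`).
[cite: Brown1982CohomologyGroups, Ch. I §5] -/
def cochainIso :
    (chains k G E).linearYonedaObj k (Rep.trivial k G M) ≅ singularCochainComplex k M B :=
  HomologicalComplex.Hom.isoOfComponents (fun n => (cochainEquiv k G hp M n).toModuleIso)
    fun i j hij => by
      obtain rfl : i + 1 = j := hij
      refine ModuleCat.hom_ext (LinearMap.ext fun f => ?_)
      exact d_toCochain k G hp M i f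

/-! ### `Hⁿ(G; M) ≅ Hⁿ(E/G; M)` -/

/-- **Group cohomology is the cohomology of the quotient of a free acyclic `G`-space**
(Brown 1982, Prop. II.4.1, "`H^*(G; M) ≅ H^*(Y; M)` for `Y` a `K(G,1)`", in the form: `E → B` a
quotient covering for the `G`-action with `E` path connected and `Hₙ(E; k) = 0` for `n ≥ 1`):
`Hⁿ(G; M) ≅ Hⁿ(B; M)` for every `k`-module `M` with trivial action — Mathlib's `groupCohomology`
computed by the free resolution `C_•(E; k) → k` (`Equivariant.resolution`, `groupCohomologyIso`)
and `Hom_G(C_•(E; k), M) ≅ C^•(B; M)` (`cochainIso`). [cite: Brown1982CohomologyGroups, Prop. II.4.1] -/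
def groupCohomologyIsoSingularCohomology [PathConnectedSpace E]
    (hE : ∀ n : ℕ, IsZero (csingularHomology k k E (n + 1))) (n : ℕ) :
    groupCohomology (Rep.trivial k G M) n ≅ singularCohomology k M B n :=
  haveI := hp.isCancelSMul
  groupCohomologyIso (Rep.trivial k G M) n (resolution k G E hE) ≪≫
    (HomologicalComplex.homologyFunctor (ModuleCat.{u} k) (ComplexShape.up ℕ) n).mapIso
      (cochainIso k G hp M)

end Equivariant

end Literature.AlgebraicTopology.SingularHomology
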